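import Summits.QuantumFields.YangMills.Theorems.UnitScaleTiltProp7IMSDoubleCommutatorDecay
import HarnessLib

/-!
# Route `UnitScaleTilt`, crux K1 «MinimiserStabilityRegPr» (stmt-QuantumFields-19200), EX row `hGF` (curved member) — **(L4-core), BANDED EDITION: THE IMS ERROR AGAINST A
# FINITE-RANGE KERNEL** (sequel of ✓`Prop7IMSDoubleCommutatorDecay`; the edition the member's LOCAL letters `Δ^η(U₀)`, `D_{U₀}D_{U₀}*`, `a·Q_k†Q_k` of (L6a) take)

Cell `ym3-torus` (HUMAN RULING D-0037, YM ladder rung R3 — NOT d = 4, NOT a mass gap, NOT Clay).  Width seat `ym-ust-19200-w5` (gen 13); chair ★`ym-ust-19200-p1` g24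
(«(L4-core) conditional GO» 2026-08-29 21:53Z; book 22:52Z: «(L6a) local coercivity of `Δ^η + DD* + aQ*Q` = IMS ✓p749039 + (L5) local gauge + flat ✓»).  THEOREMS ONLY
(0 `def`, 0 `sorry`); `--supports stmt-QuantumFields-19200 --as helper`, count-neutral.  HONEST LABEL (№33 (6)): curved γ-row supplier line (LOD localisation), CONDITIONAL on
the member bricks; ONE Thm 3.1-class Agmon brick (L3′) inside, Track A road cited; nothing of (3.49), Thm 3.3, `h349`, `hGF`, EX or the crux proved.

WHY A SEQUEL.  ✓`Prop7IMSDoubleCommutatorDecay.norm_imsError_le_of_decay` takes an EXPONENTIAL-DECAY hypothesis with a second-moment bound `Σ_k d(i,k)²e^{−μd(i,k)} ≤ S` over ALL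
indices; its docstring's parenthetical «banded kernel: take `μ = 0`, `S = N_r·r²`» is WRONG as written (with `μ = 0` the moment sum runs over every index, not over the band) —
ERRATUM recorded here.  The banded case is the separate, elementary lemma below: `A_{ik} = 0` beyond `d`-range `r`, `‖A_{ik}‖ ≤ t`, at most `N` indices within range ⟹ error
`≤ ℓ²·t·N·r²·Σ‖v_i‖²`.  At the member (fine bond⊗entry index, fine-Lipschitz cutoffs `ℓ = η∕R_cube` per fine step, `ηℓ_block = 1`): `Δ^η`, `DD*` have `t ~ η⁻²`, `r, N = O(1)`
⟹ `O(R_cube⁻²)`; `aQ_k†Q_k` has `t ~ a₀η³`-class entries, `r ~ 2ℓ_block`, `N ~ (4ℓ_block)³` ⟹ `O(a₀∕R_cube²)` — all K-uniform.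

WHAT IS PROVED (ns `…Theorems.Prop7IMSDoubleCommutatorRange`).
* ★★ `norm_imsError_le_of_range`; ★★★ `ims_lowerBound_of_range` (floor `σ − ℓ²tNr²∕2`).
WHY IT MIGHT FAIL: nothing for the algebra; the member must exhibit the band data `(r, t, N)` of its three local letters in ONE pseudo-metric with `d ≥ 0`.

References: B. Simon, Ann. Inst. H. Poincaré A **38** (1983) 295–308; T. Bałaban, CMP **99** (1985) 389–434 [Balaban1985BackgroundPropagators] ((3.10)–(3.12) p.392, Thm 3.11 p.416).
-/

set_option autoImplicit false

noncomputable section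

open scoped Matrix ComplexConjugate BigOperators
open Finset

namespace Summit.QuantumFields.YangMills.Theorems.Prop7IMSDoubleCommutatorRange

open Summit.QuantumFields.YangMills.Theorems.Prop7IMSDoubleCommutatorDecay (norm_sum_sum_le_of_row_col ims_lowerBound_complex)

variable {n B : Type*} [Fintype n] [Fintype B]

/-- ★★ **THE IMS ERROR AGAINST A BANDED KERNEL**: if the partition is jointly `ℓ`-Lipschitz in the nonnegative symmetric pseudo-metric `d` (`Σ_b (h b i − h b k)² ≤ ℓ²·d(i,k)²`),
`A_{ik} = 0` whenever `d(i,k) > r`, `‖A_{ik}‖ ≤ t`, and every index has at most `N` indices within `d`-distance `r`, then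
`‖Σ_b Σ_{i,k} (h b i − h b k)²·(v̄_i A_{ik} v_k)‖ ≤ ℓ²·t·N·r²·Σ_i‖v_i‖²` (row∕column sums over the band only, then the Schur test of the prequel).
[cite: Balaban1985BackgroundPropagators, (3.10)-(3.12) p.392, Thm 3.11 p.416] -/
theorem norm_imsError_le_of_range (A : Matrix n n ℂ) (h : B → n → ℝ) (d : n → n → ℝ) (hds : ∀ i k, d i k = d k i) (hdnn : ∀ i k, 0 ≤ d i k)
    {ℓ t r : ℝ} {N : ℕ} (ht : 0 ≤ t)
    (hLip : ∀ i k, ∑ b, (h b i - h b k) ^ 2 ≤ ℓ ^ 2 * d i k ^ 2)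
    (hAr : ∀ i k, r < d i k → A i k = 0) (hAt : ∀ i k, ‖A i k‖ ≤ t)
    (hN : ∀ i, (univ.filter fun k => d i k ≤ r).card ≤ N) (v : n → ℂ) :
    ‖∑ b, ∑ i, ∑ k, (((h b i - h b k) ^ 2 : ℝ) : ℂ) * (star (v i) * A i k * v k)‖ ≤ ℓ ^ 2 * t * N * r ^ 2 * ∑ i, ‖v i‖ ^ 2 := by
  classical
  set E : Matrix n n ℂ := fun i k => ((∑ b, (h b i - h b k) ^ 2 : ℝ) : ℂ) * A i k with hE
  have hsum : ∑ b, ∑ i, ∑ k, (((h b i - h b k) ^ 2 : ℝ) : ℂ) * (star (v i) * A i k * v k) = ∑ i, ∑ k, star (v i) * E i k * v k := by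
    rw [Finset.sum_comm]
    refine Finset.sum_congr rfl fun i _ => ?_
    rw [Finset.sum_comm]
    refine Finset.sum_congr rfl fun k _ => ?_
    rw [← Finset.sum_mul, hE]
    push_cast
    ring
  rw [hsum]
  -- entries: zero beyond range `r`, at most `ℓ²r²t` within
  have hEz : ∀ i k, r < d i k → E i k = 0 := fun i k hik => by
    show ((∑ b, (h b i - h b k) ^ 2 : ℝ) : ℂ) * A i k = 0
    rw [hAr i k hik, mul_zero]
  have hEb : ∀ i k, d i k ≤ r → ‖E i k‖ ≤ ℓ ^ 2 * r ^ 2 * t := by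
    intro i k hik
    show ‖((∑ b, (h b i - h b k) ^ 2 : ℝ) : ℂ) * A i k‖ ≤ _
    rw [norm_mul, Complex.norm_real, Real.norm_eq_abs, abs_of_nonneg (Finset.sum_nonneg fun b _ => sq_nonneg _)]
    have hsq : d i k ^ 2 ≤ r ^ 2 := by nlinarith [hdnn i k, hik]
    calc (∑ b, (h b i - h b k) ^ 2) * ‖A i k‖ ≤ (ℓ ^ 2 * d i k ^ 2) * t := mul_le_mul (hLip i k) (hAt i k) (norm_nonneg _) (by positivity)
      _ ≤ (ℓ ^ 2 * r ^ 2) * t := mul_le_mul_of_nonneg_right (mul_le_mul_of_nonneg_left hsq (sq_nonneg _)) ht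
      _ = ℓ ^ 2 * r ^ 2 * t := by ring
  -- row sums over the band
  have hband : ∀ i, (∑ k ∈ univ.filter (fun k => d i k ≤ r), ‖E i k‖) ≤ ℓ ^ 2 * t * N * r ^ 2 := by
    intro i
    calc ∑ k ∈ univ.filter (fun k => d i k ≤ r), ‖E i k‖ ≤ ∑ k ∈ univ.filter (fun k => d i k ≤ r), ℓ ^ 2 * r ^ 2 * t :=
          Finset.sum_le_sum fun k hk => hEb i k (Finset.mem_filter.mp hk).2
      _ = ((univ.filter fun k => d i k ≤ r).card : ℝ) * (ℓ ^ 2 * r ^ 2 * t) := by rw [Finset.sum_const, nsmul_eq_mul]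
      _ ≤ (N : ℝ) * (ℓ ^ 2 * r ^ 2 * t) := mul_le_mul_of_nonneg_right (by exact_mod_cast hN i) (by positivity)
      _ = ℓ ^ 2 * t * N * r ^ 2 := by ring
  have hrow : ∀ i, ∑ k, ‖E i k‖ ≤ ℓ ^ 2 * t * N * r ^ 2 := by
    intro i
    have hsplit : ∑ k, ‖E i k‖ = ∑ k ∈ univ.filter (fun k => d i k ≤ r), ‖E i k‖ := by
      rw [← Finset.sum_filter_add_sum_filter_not univ (fun k => d i k ≤ r),
        Finset.sum_eq_zero (s := univ.filter fun k => ¬ d i k ≤ r), add_zero]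
      intro k hk
      rw [hEz i k (lt_of_not_ge (Finset.mem_filter.mp hk).2), norm_zero]
    rw [hsplit]
    exact hband i
  have hcol : ∀ k, ∑ i, ‖E i k‖ ≤ ℓ ^ 2 * t * N * r ^ 2 := by
    intro k
    -- `‖E i k‖ = ‖E' k i‖` for the transposed data, which satisfy the same hypotheses by symmetry; we redo the row argument with `d k i`
    have hsplit : ∑ i, ‖E i k‖ = ∑ i ∈ univ.filter (fun i => d k i ≤ r), ‖E i k‖ := by
      rw [← Finset.sum_filter_add_sum_filter_not univ (fun i => d k i ≤ r),
        Finset.sum_eq_zero (s := univ.filter fun i => ¬ d k i ≤ r), add_zero]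
      intro i hi
      have hki : r < d i k := by rw [hds i k]; exact lt_of_not_ge (Finset.mem_filter.mp hi).2
      rw [hEz i k hki, norm_zero]
    rw [hsplit]
    calc ∑ i ∈ univ.filter (fun i => d k i ≤ r), ‖E i k‖ ≤ ∑ i ∈ univ.filter (fun i => d k i ≤ r), ℓ ^ 2 * r ^ 2 * t :=
          Finset.sum_le_sum fun i hi => hEb i k (by rw [hds i k]; exact (Finset.mem_filter.mp hi).2)
      _ = ((univ.filter fun i => d k i ≤ r).card : ℝ) * (ℓ ^ 2 * r ^ 2 * t) := by rw [Finset.sum_const, nsmul_eq_mul]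
      _ ≤ (N : ℝ) * (ℓ ^ 2 * r ^ 2 * t) := mul_le_mul_of_nonneg_right (by exact_mod_cast hN k) (by positivity)
      _ = ℓ ^ 2 * t * N * r ^ 2 := by ring
  exact norm_sum_sum_le_of_row_col E hrow hcol v

/-- ★★★ **IMS WITH A BANDED KERNEL — THE CLOSER**: block floors `σ` on the supports of an `ℓ`-Lipschitz quadratic partition of unity and a kernel of `d`-range `r`, entries `≤ t`,
`≤ N` neighbours ⟹ `(σ − ℓ²·t·N·r²∕2)·Σ_i‖v_i‖² ≤ Re Σ_i v̄_i (Av)_i` (✓`ims_lowerBound_complex` at `ρ = ℓ²tNr²∕2`) — constants `σ, ℓ, t, N, r` only.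
[cite: Balaban1985BackgroundPropagators, (3.10)-(3.12) p.392, Thm 3.11 p.416] -/
theorem ims_lowerBound_of_range (A : Matrix n n ℂ) (h : B → n → ℝ) (hpart : ∀ i, ∑ b, h b i ^ 2 = 1)
    (d : n → n → ℝ) (hds : ∀ i k, d i k = d k i) (hdnn : ∀ i k, 0 ≤ d i k) {σ ℓ t r : ℝ} {N : ℕ} (ht : 0 ≤ t)
    (hLip : ∀ i k, ∑ b, (h b i - h b k) ^ 2 ≤ ℓ ^ 2 * d i k ^ 2)
    (hAr : ∀ i k, r < d i k → A i k = 0) (hAt : ∀ i k, ‖A i k‖ ≤ t)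
    (hN : ∀ i, (univ.filter fun k => d i k ≤ r).card ≤ N)
    (hblock : ∀ (b : B) (w : n → ℂ), (∀ i, h b i = 0 → w i = 0) → σ * ∑ i, ‖w i‖ ^ 2 ≤ (∑ i, star (w i) * (A *ᵥ w) i).re)
    (v : n → ℂ) : (σ - ℓ ^ 2 * t * N * r ^ 2 / 2) * ∑ i, ‖v i‖ ^ 2 ≤ (∑ i, star (v i) * (A *ᵥ v) i).re := by
  refine ims_lowerBound_complex A h hpart hblock (fun w => ?_) v
  have := norm_imsError_le_of_range A h d hds hdnn ht hLip hAr hAt hN w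
  linarith

end Summit.QuantumFields.YangMills.Theorems.Prop7IMSDoubleCommutatorRange

end
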